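import Summits.CriticalPhenomena.PercolationContinuityZ3.Theorems.PercNearOneGluingNoHeavyLowerTailThreePointTransplantRecipes
import HarnessLib

/-!
# The neutral transplant (`Y = ∅`, the 'flip') moves a cluster across the two copies (Sahi programme, prover prim-sahi-p2 gen 52)

Support file (`--supports stmt-CriticalPhenomena-4575`, helper), continuing `…ThreePointTransplantRecipes` (the recipes `recipe x Y`).  Standard
axioms, no sorries, no definitions.  Memo `run/shared/lean/prim/prim-sahi/FROM-prim-sahi-p2-gen52-TRANSPLANT-DICTIONARY.md` §6b, `prim-sahi-p2/PROOF-E3.md` (62j)(vii).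

The neutral recipe `recipe x ∅` swaps the two copies on the star of the copy-1 cluster of `x` (in fibre language it is the lane's flip
`T ↦ T △ Ē(C_x(T))`, now known to be a bijection by `TransplantRecipes.recipe_injective`).  This file records the structural facts the orbit
analysis of the memo starts from:
* `ghost_empty`, `ghostVerts_empty`, `recipeSet_empty`, `recipe_empty` — with no ghost, the recipe is never void and its swap set is the full star
  `cutSet x θ₁` of the copy-1 cluster. [this work]
* **`cutSet_snd_recipe_empty`**, **`reachable_snd_recipe_empty_iff`** — THE CLUSTER MOVES ACROSS: after `recipe x ∅`, the copy-2 cluster of `x`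
  is exactly the old copy-1 cluster of `x` (`C_x(new θ₂) = C_x(old θ₁)`). [this work]
* **`conn_snd_recipe_empty_iff`** — hence for every vertex `u`: `x ↔ u` in the new copy 2 iff `x ↔ u` in the old copy 1; in particular, with
  `x = s`, `{s ↮ c}` holds in the new copy 2 iff it held in the old copy 1 (`not_conn_snd_recipe_empty_iff`) — the identity
  `D(copy 2, step k+1) = ¬SC(copy 1, step k)` along the `(s,∅)`-dynamics that turns the two-copy fibre count `N_{U×D}` into the
  one-configuration count `#{T : s ≁_T c, a ~ {s,c} in T △ Ē(C_s(T))}` (memo §6b(a)).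
[cite: Gladkov2024, Def. 2.3–2.4 (cluster hybrids)]; [cite: VandenbergHaggstromKahn2005, §1 pp. 7–8 (the pairs meeting a cluster)].
-/

noncomputable section

open Classical

namespace Summit.CriticalPhenomena.PercolationContinuityZ3.Theorems

namespace TransplantRecipes

open Literature.Probability.Percolation
open Literature.Probability.Percolation.ClusterConditioning (cutSet)

variable {V : Type*}

/-- With no ghost roots there are no ghost pairs. [this work] -/
theorem ghost_empty (θ₂ : BondConfig V) : ghost (∅ : Finset V) θ₂ = ∅ := by
  ext e; simp [ghost]

/-- With no ghost roots there are no ghost vertices. [this work] -/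
theorem ghostVerts_empty (θ₂ : BondConfig V) : ghostVerts (∅ : Finset V) θ₂ = ∅ := by
  ext x; simp [ghostVerts]

/-- With no ghost, the swap set is the full star of the copy-1 cluster of `x`. [this work] -/
theorem recipeSet_empty (x : V) (θ : BondConfig V × BondConfig V) : recipeSet x ∅ θ = cutSet x θ.1 := by
  unfold recipeSet
  rw [ghost_empty, Set.sdiff_empty, Set.sdiff_empty]

/-- With no ghost, the recipe is never void: it is the swap on the star of `C_x(θ₁)`. [this work] -/
theorem recipe_empty (x : V) (θ : BondConfig V × BondConfig V) : recipe x ∅ θ = swap (cutSet x θ.1) θ := by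
  unfold recipe
  rw [ghostVerts_empty, if_neg (Set.notMem_empty x), recipeSet_empty]

/-- **THE CLUSTER MOVES ACROSS**: after the neutral transplant, the pairs meeting the copy-2 cluster of `x` are exactly the pairs meeting the old
copy-1 cluster of `x`. [this work] -/
theorem cutSet_snd_recipe_empty (x : V) (θ : BondConfig V × BondConfig V) :
    cutSet x (recipe x ∅ θ).2 = cutSet x θ.1 := by
  have h := recipeInvSet_swap x ∅ θ
  unfold recipeInvSet at h
  rw [ghost_swap_recipeSet, ghost_empty, Set.sdiff_empty, Set.sdiff_empty, recipeSet_empty] at h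
  unfold recipe
  rw [ghostVerts_empty, if_neg (Set.notMem_empty x), recipeSet_empty]
  exact h

/-- **THE CLUSTER MOVES ACROSS** (vertex form): `x ↔ u` in the new copy 2 iff `x ↔ u` in the old copy 1. [this work] -/
theorem reachable_snd_recipe_empty_iff (x : V) (θ : BondConfig V × BondConfig V) (u : V) :
    (openGraph (recipe x ∅ θ).2).Reachable x u ↔ (openGraph θ.1).Reachable x u := by
  have h := cutSet_snd_recipe_empty x θ
  constructor
  · intro hu
    have : s(u, u) ∈ cutSet x (recipe x ∅ θ).2 := ⟨u, Sym2.mem_mk_left u u, hu⟩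
    rw [h] at this
    obtain ⟨v, hv, hr⟩ := this
    have hv' : v = u := by
      rcases Sym2.mem_iff.1 hv with h1 | h1 <;> exact h1
    rw [hv'] at hr; exact hr
  · intro hu
    have : s(u, u) ∈ cutSet x θ.1 := ⟨u, Sym2.mem_mk_left u u, hu⟩
    rw [← h] at this
    obtain ⟨v, hv, hr⟩ := this
    have hv' : v = u := by
      rcases Sym2.mem_iff.1 hv with h1 | h1 <;> exact h1
    rw [hv'] at hr; exact hr

/-- The event form: the new copy 2 lies in `{x ↔ u}` iff the old copy 1 does. [this work] -/
theorem conn_snd_recipe_empty_iff (x u : V) (θ : BondConfig V × BondConfig V) :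
    (recipe x ∅ θ).2 ∈ (openConn x u : Set (BondConfig V)) ↔ θ.1 ∈ (openConn x u : Set (BondConfig V)) :=
  reachable_snd_recipe_empty_iff x θ u

/-- In particular (`x = s`, `u = c`): along the `(s, ∅)`-transplant, "`s ↮ c` in the new copy 2" iff "`s ↮ c` in the old copy 1" — the identity
`D(copy 2, next) = ¬SC(copy 1, now)` of the memo §6b(a). [this work] -/
theorem not_conn_snd_recipe_empty_iff (s c : V) (θ : BondConfig V × BondConfig V) :
    (recipe s ∅ θ).2 ∈ ((openConn s c)ᶜ : Set (BondConfig V)) ↔ θ.1 ∈ ((openConn s c)ᶜ : Set (BondConfig V)) := by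
  rw [Set.mem_compl_iff, Set.mem_compl_iff, not_iff_not]
  exact conn_snd_recipe_empty_iff s c θ

end TransplantRecipes

end Summit.CriticalPhenomena.PercolationContinuityZ3.Theorems

end
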